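import Literature.Analysis.FluidPDE.RepresentedDerivativesCalculus
import Literature.Analysis.FluidPDE.NSBoundedVorticityReduction
import HarnessLib

/-!
# The Serrin bootstrap for bounded distributional Navier–Stokes solutions: bookkeeping

Analysis/FluidPDE definitions file. The higher-regularity theorem with constants
(`NSBoundedHigherRegularityBounds`; Seregin–Šverák 2009, §2 p. 8; Serrin 1962; Lemarié-Rieusset
2016, Thm. 13.1: "By induction, we find that `∂^α ω` is locally `L^∞L^∞` for all `α ∈ ℕᵈ`… ")
is proved by an induction on the number of space derivatives, run on the normalised cylinders
`C(L, ρ) = ]-L, 0[ × B(0, ρ) ⊆ ℝ × ℝ³`. This file fixes the objects of the induction: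

* `cyl L ρ`, `cylOpens L ρ`, the frame `frame = (e₀, e₁, e₂)`;
* the **base identities** on `C(L, ρ)`: the weak spin (vorticity) equation `BaseHeat`
  (`∫ A_{bc}(∂ₜψ + Δψ) = ∫ ⟪spinFlux_{bc}, ∇ψ⟫`) and the very weak Poisson equations
  `BasePoisson` (`∫ u_b Δψ = -Σ_c ∫ A_{bc} ∂_cψ`, i.e. `Δu_b = Σ_c ∂_c A_{bc}`,
  `A_{bc} = ∂_c u_b - ∂_b u_c`);
* the **level data** `LevelData u G L ρ k K U A`: for every multi-index `γ` (a list over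
  `Fin 3`) of length `≤ k`, functions `U γ b`, `A γ b c` representing `∂^γ u_b`, `∂^γ A_{bc}` on
  `C(L, ρ)` (`RepDeriv.IsRepDeriv`) and essentially bounded there by `K`;
* the **Leibniz expansions** `splits γ`, `prodRep U A γ l b l'` (the function representing
  `∂^γ (u_l A_{bl'})`, a sum over the `2^{|γ|}` ordered splittings of `γ`) and the flux
  components `fluxRep U A γ b c i` representing `∂^γ ⟪spinFlux_{bc}, eᵢ⟫`.

Only definitions and their unfolding / monotonicity lemmas are here; the analysis is in the
sequel files.

## References

* G. Seregin, V. Šverák, Comm. PDE 34 (2009) = arXiv:0804.1803, §2 p. 8. [`SereginSverak2009`]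
* P. G. Lemarié-Rieusset, *The Navier–Stokes Problem in the 21st Century* (2016), Thm. 13.1.
  [`LemarieRieusset2016`]
* J. Serrin, Arch. Rational Mech. Anal. 9 (1962) 187–195. [folklore]
-/

noncomputable section

open MeasureTheory Set Function Filter Topology TopologicalSpace Metric
open scoped NNReal ENNReal RealInnerProductSpace Laplacian

namespace Literature.Analysis.FluidPDE

namespace NSBootstrap

open RepDeriv

/-- The normalised cylinder `C(L, ρ) = ]-L, 0[ × B(0, ρ)` (top time `0`, centre `0`). [folklore] -/
abbrev cyl (L ρ : ℝ) : Set (ℝ × EuclideanSpace ℝ (Fin 3)) :=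
  Ioo (-L) 0 ×ˢ ball (0 : EuclideanSpace ℝ (Fin 3)) ρ

/-- The normalised cylinder as an open set. [folklore] -/
abbrev cylOpens (L ρ : ℝ) : Opens (ℝ × EuclideanSpace ℝ (Fin 3)) :=
  ⟨cyl L ρ, isOpen_Ioo.prod isOpen_ball⟩

/-- The standard frame of `ℝ³`. [folklore] -/
abbrev frame : OrthonormalBasis (Fin 3) ℝ (EuclideanSpace ℝ (Fin 3)) :=
  EuclideanSpace.basisFun (Fin 3) ℝ

/-- Smaller cylinders are contained in larger ones. [folklore] -/
theorem cyl_mono {L L' ρ ρ' : ℝ} (hL : L' ≤ L) (hρ : ρ' ≤ ρ) : cyl L' ρ' ⊆ cyl L ρ :=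
  prod_mono (Ioo_subset_Ioo (by linarith) le_rfl) (ball_subset_ball hρ)

/-- Smaller cylinders are contained in larger ones (open sets). [folklore] -/
theorem cylOpens_mono {L L' ρ ρ' : ℝ} (hL : L' ≤ L) (hρ : ρ' ≤ ρ) : cylOpens L' ρ' ≤ cylOpens L ρ :=
  fun _ hq => cyl_mono hL hρ hq

variable (u : ℝ → EuclideanSpace ℝ (Fin 3) → EuclideanSpace ℝ (Fin 3))
  (G : ℝ → EuclideanSpace ℝ (Fin 3) → EuclideanSpace ℝ (Fin 3) →L[ℝ] EuclideanSpace ℝ (Fin 3))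

/-- **The weak spin (vorticity) equation on `C(L, ρ)`**:
`∫ A_{bc}(∂ₜψ + Δψ) = ∫ ⟪spinFlux_{bc}, ∇ψ⟫` for all test functions `ψ` on the cylinder
(Robinson–Rodrigo–Sadowski 2016, (12.4)). [folklore] -/
def BaseHeat (L ρ : ℝ) : Prop :=
  ∀ (b c : Fin 3) (ψ : ℝ → EuclideanSpace ℝ (Fin 3) → ℝ), IsSpaceTimeTestOn (cylOpens L ρ) ψ →
    ∫ q : ℝ × EuclideanSpace ℝ (Fin 3), spinEntry G b c q * (timeDeriv ψ q.1 q.2 + (Δ (ψ q.1)) q.2) =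
      ∫ q : ℝ × EuclideanSpace ℝ (Fin 3), ⟪spinFlux u G b c q, gradient (ψ q.1) q.2⟫

/-- **The very weak Poisson equations on `C(L, ρ)`**: `∫ u_b Δψ = -Σ_c ∫ A_{bc} ∂_cψ` for all
test functions `ψ` on the cylinder (`Δu_b = Σ_c ∂_c(∂_c u_b - ∂_b u_c)` for a divergence-free
field). [folklore] -/
def BasePoisson (L ρ : ℝ) : Prop :=
  ∀ (b : Fin 3) (ψ : ℝ → EuclideanSpace ℝ (Fin 3) → ℝ), IsSpaceTimeTestOn (cylOpens L ρ) ψ →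
    ∫ q : ℝ × EuclideanSpace ℝ (Fin 3), u q.1 q.2 b * (Δ (ψ q.1)) q.2 =
      -∑ c, ∫ q : ℝ × EuclideanSpace ℝ (Fin 3), spinEntry G b c q * fderiv ℝ (ψ q.1) q.2 (frame c)

/-- **Level-`k` data on `C(L, ρ)` with bound `K`**: for every multi-index `γ` of length `≤ k`
and all indices, `U γ b` represents `∂^γ u_b` and `A γ b c` represents `∂^γ A_{bc}` on the
cylinder, and both are essentially bounded there by `K`. [folklore] -/
def LevelData (L ρ : ℝ) (k : ℕ) (K : ℝ≥0)
    (U : List (Fin 3) → Fin 3 → ℝ × EuclideanSpace ℝ (Fin 3) → ℝ)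
    (A : List (Fin 3) → Fin 3 → Fin 3 → ℝ × EuclideanSpace ℝ (Fin 3) → ℝ) : Prop :=
  ∀ γ : List (Fin 3), γ.length ≤ k → ∀ b c : Fin 3,
    IsRepDeriv (cylOpens L ρ) (fun q => u q.1 q.2 b) (γ.map frame) (U γ b) ∧
    IsRepDeriv (cylOpens L ρ) (spinEntry G b c) (γ.map frame) (A γ b c) ∧
    (∀ᵐ q ∂(volume.restrict (cyl L ρ)), |U γ b q| ≤ K) ∧
    (∀ᵐ q ∂(volume.restrict (cyl L ρ)), |A γ b c q| ≤ K)

variable {u G}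

/-- Restriction of the base heat identity to a smaller cylinder. [folklore] -/
theorem BaseHeat.mono {L L' ρ ρ' : ℝ} (h : BaseHeat u G L ρ) (hL : L' ≤ L) (hρ : ρ' ≤ ρ) :
    BaseHeat u G L' ρ' :=
  fun b c ψ hψ => h b c ψ (hψ.mono (cylOpens_mono hL hρ))

/-- Restriction of the base Poisson identities to a smaller cylinder. [folklore] -/
theorem BasePoisson.mono {L L' ρ ρ' : ℝ} (h : BasePoisson u G L ρ) (hL : L' ≤ L) (hρ : ρ' ≤ ρ) :
    BasePoisson u G L' ρ' :=
  fun b ψ hψ => h b ψ (hψ.mono (cylOpens_mono hL hρ))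

/-- Restriction of level data to a smaller cylinder, fewer derivatives and a larger bound.
[folklore] -/
theorem LevelData.mono {L L' ρ ρ' : ℝ} {k k' : ℕ} {K K' : ℝ≥0}
    {U : List (Fin 3) → Fin 3 → ℝ × EuclideanSpace ℝ (Fin 3) → ℝ}
    {A : List (Fin 3) → Fin 3 → Fin 3 → ℝ × EuclideanSpace ℝ (Fin 3) → ℝ}
    (h : LevelData u G L ρ k K U A) (hL : L' ≤ L) (hρ : ρ' ≤ ρ) (hk : k' ≤ k) (hK : K ≤ K') :
    LevelData u G L' ρ' k' K' U A := by
  intro γ hγ b c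
  obtain ⟨h1, h2, h3, h4⟩ := h γ (hγ.trans hk) b c
  have hsub : cyl L' ρ' ⊆ cyl L ρ := cyl_mono hL hρ
  refine ⟨h1.mono (cylOpens_mono hL hρ), h2.mono (cylOpens_mono hL hρ), ?_, ?_⟩
  · exact (ae_restrict_of_ae_restrict_of_subset hsub h3).mono fun q hq => hq.trans (by exact_mod_cast hK)
  · exact (ae_restrict_of_ae_restrict_of_subset hsub h4).mono fun q hq => hq.trans (by exact_mod_cast hK)

/-! ### Leibniz expansions -/

/-- The ordered splittings of a multi-index into two: `splits [] = [([], [])]`,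
`splits (i :: γ) = [(i :: α, β), (α, i :: β) | (α, β) ∈ splits γ]` (the `2^{|γ|}` terms of the
Leibniz formula for `∂^γ (f g)`). [folklore] -/
def splits : List (Fin 3) → List (List (Fin 3) × List (Fin 3))
  | [] => [([], [])]
  | i :: γ => (splits γ).flatMap fun s => [(i :: s.1, s.2), (s.1, i :: s.2)]

/-- `splits [] = [([], [])]`. [folklore] -/
@[simp]
theorem splits_nil : splits [] = [([], [])] := rfl

/-- `splits (i :: γ)`. [folklore] -/
@[simp]
theorem splits_cons (i : Fin 3) (γ : List (Fin 3)) :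
    splits (i :: γ) = (splits γ).flatMap fun s => [(i :: s.1, s.2), (s.1, i :: s.2)] := rfl

/-- The lengths of the two parts of a splitting add up to the length of the multi-index. [folklore] -/
theorem length_add_of_mem_splits {γ : List (Fin 3)} {s : List (Fin 3) × List (Fin 3)}
    (hs : s ∈ splits γ) : s.1.length + s.2.length = γ.length := by
  induction γ generalizing s with
  | nil =>
    simp only [splits_nil, List.mem_singleton] at hs
    subst hs; rfl
  | cons i γ ih =>
    simp only [splits_cons, List.mem_flatMap, List.mem_cons, List.mem_nil_iff, or_false] at hs
    obtain ⟨s', hs', h | h⟩ := hs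
    · subst h
      simp only [List.length_cons]
      have := ih hs'
      omega
    · subst h
      simp only [List.length_cons]
      have := ih hs'
      omega

/-- The number of splittings is `2^{|γ|}`. [folklore] -/
theorem length_splits (γ : List (Fin 3)) : (splits γ).length = 2 ^ γ.length := by
  induction γ with
  | nil => rfl
  | cons i γ ih =>
    rw [splits_cons, List.length_flatMap, List.length_cons, pow_succ]
    simp only [List.length_cons, List.length_nil, List.map_const', List.sum_replicate, smul_eq_mul,
      ih, mul_comm]

/-- **The function representing `∂^γ (u_l A_{b l'})`** built from level data by the Leibniz
formula: `Σ_{(α, β) ∈ splits γ} (U α l) (A β b l')`. [folklore] -/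
def prodRep (U : List (Fin 3) → Fin 3 → ℝ × EuclideanSpace ℝ (Fin 3) → ℝ)
    (A : List (Fin 3) → Fin 3 → Fin 3 → ℝ × EuclideanSpace ℝ (Fin 3) → ℝ)
    (γ : List (Fin 3)) (l b l' : Fin 3) (q : ℝ × EuclideanSpace ℝ (Fin 3)) : ℝ :=
  ((splits γ).map fun s => U s.1 l q * A s.2 b l' q).sum

/-- `prodRep` at order zero is the product itself. [folklore] -/
@[simp]
theorem prodRep_nil (U : List (Fin 3) → Fin 3 → ℝ × EuclideanSpace ℝ (Fin 3) → ℝ)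
    (A : List (Fin 3) → Fin 3 → Fin 3 → ℝ × EuclideanSpace ℝ (Fin 3) → ℝ) (l b l' : Fin 3)
    (q : ℝ × EuclideanSpace ℝ (Fin 3)) : prodRep U A [] l b l' q = U [] l q * A [] b l' q := by
  simp [prodRep]

/-- **The function representing `∂^γ ⟪spinFlux_{bc}, eᵢ⟫`**:
`⟪spinFlux_{bc}, eᵢ⟫ = -⟪e_c, eᵢ⟫ Σ_l u_l A_{bl} + ⟪e_b, eᵢ⟫ Σ_l u_l A_{cl}`. [folklore] -/
def fluxRep (U : List (Fin 3) → Fin 3 → ℝ × EuclideanSpace ℝ (Fin 3) → ℝ)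
    (A : List (Fin 3) → Fin 3 → Fin 3 → ℝ × EuclideanSpace ℝ (Fin 3) → ℝ)
    (γ : List (Fin 3)) (b c i : Fin 3) (q : ℝ × EuclideanSpace ℝ (Fin 3)) : ℝ :=
  -(⟪(frame c : EuclideanSpace ℝ (Fin 3)), frame i⟫ * ∑ l, prodRep U A γ l b l q) +
    ⟪(frame b : EuclideanSpace ℝ (Fin 3)), frame i⟫ * ∑ l, prodRep U A γ l c l q

/-- The components of the spin flux in the frame:
`⟪spinFlux u G b c, eᵢ⟫ = -⟪e_c, eᵢ⟫ Σ_l u_l A_{bl} + ⟪e_b, eᵢ⟫ Σ_l u_l A_{cl}`. [folklore] -/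
theorem inner_spinFlux_frame (b c i : Fin 3) (q : ℝ × EuclideanSpace ℝ (Fin 3)) :
    ⟪spinFlux u G b c q, frame i⟫ =
      -(⟪(frame c : EuclideanSpace ℝ (Fin 3)), frame i⟫ * ∑ l, u q.1 q.2 l * spinEntry G b l q) +
        ⟪(frame b : EuclideanSpace ℝ (Fin 3)), frame i⟫ * ∑ l, u q.1 q.2 l * spinEntry G c l q := by
  simp only [spinFlux, inner_add_left, real_inner_smul_left, frame, EuclideanSpace.basisFun_apply]
  ring

end NSBootstrap

end Literature.Analysis.FluidPDE

end
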